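import Mathlib
import HarnessLib
import Literature.MathematicalPhysics.QuantumLattice.GaugeGroups
import Literature.MathematicalPhysics.QuantumFieldTheory.ConstructiveQFTWave0
import Summits.Ventures.LatticeQCDFlow.Scaling.SU2Sphere

/-!
# Haar measure on `SU(2)` is the normalised surface measure of `S³` (pub-lqcd THEORY-2 v2.3, #21b)

HONEST FRAMING: exact (Metropolis-corrected) sampling algorithms for lattice gauge theory;
figures of merit are autocorrelation/cost numbers at stated couplings and volumes;
no continuum-physics claim.

With `homeoS3 : SU(2) ≃ₜ S³ ⊂ ℝ⁴` and the rotations `rot V` of #21a: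

* `sphereMeasure` = Mathlib's `volume.toSphere` on `S³` (`σ(s) = 4·vol(cone(s) ∩ ball)`), which is
  invariant under every linear isometry, in particular under `rotSphere V`
  (`sphereMeasure_preimage_rotSphere`);
* its transport `liftMeasure` to `SU(2)` is therefore LEFT-INVARIANT and finite, hence, by the
  uniqueness of Haar measure (`MeasureTheory.Measure.haarMeasure_unique`), a constant multiple of
  the tree's `haarProbability SU(2)` (`liftMeasure_eq_smul`);
* consequently the Haar probability of the ACTION BALL `{U : 2 - Re tr U ≤ r²}` is the
  normalised Lebesgue volume of the cone over the spherical cap `{y ∈ S³ : 2 - 2y₀ ≤ r²}`: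
  `haarProbability_actionBall` — the formula #21c turns into the two-sided `r³` law.

Textbook (`SU(2) ≅ S³`, Haar = normalised volume); not in Mathlib at the pin.
-/

noncomputable section

open Matrix Complex MeasureTheory Measure Set Metric
open Literature.MathematicalPhysics.QuantumFieldTheory
open scoped ComplexConjugate Pointwise ENNReal

namespace Summit.Ventures.LatticeQCDFlow.Theory2.Lattice.SU2

/-- The surface measure of `S³ ⊂ ℝ⁴` induced by Lebesgue measure (`σ(s) = 4·vol(Ioo 0 1 • s)`). -/
def sphereMeasure : Measure (sphere (0 : R4) 1) := (volume : Measure R4).toSphere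

/-- `sphereMeasure` is finite. -/
instance : IsFiniteMeasure sphereMeasure := by
  unfold sphereMeasure; infer_instance

/-- The cone over a set of the sphere is carried to the cone by a rotation:
`Ioo 0 1 • (rotSphere V ⁻¹' s) = (rot V) ⁻¹' (Ioo 0 1 • s)`. -/
theorem cone_preimage_rotSphere (V : G2) (s : Set (sphere (0 : R4) 1)) :
    Ioo (0 : ℝ) 1 • (((↑) : sphere (0 : R4) 1 → R4) '' (rotSphere V ⁻¹' s)) =
      (rot V) ⁻¹' (Ioo (0 : ℝ) 1 • (((↑) : sphere (0 : R4) 1 → R4) '' s)) := by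
  ext x
  simp only [Set.mem_smul, Set.mem_image, Set.mem_preimage]
  constructor
  · rintro ⟨t, ht, _, ⟨y, hy, rfl⟩, rfl⟩
    refine ⟨t, ht, rot V y, ⟨rotSphere V y, hy, rfl⟩, ?_⟩
    simp
  · rintro ⟨t, ht, _, ⟨z, hz, rfl⟩, h⟩
    have hmem : (⟨(rot V).symm z, by simp⟩ : sphere (0 : R4) 1) ∈ rotSphere V ⁻¹' s := by
      rw [Set.mem_preimage]
      have : rotSphere V ⟨(rot V).symm z, by simp⟩ = z := by
        apply Subtype.ext
        simp [rotSphere]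
      rw [this]; exact hz
    refine ⟨t, ht, (rot V).symm z, ⟨⟨(rot V).symm z, by simp⟩, hmem, rfl⟩, ?_⟩
    apply (rot V).injective
    rw [map_smul, LinearIsometryEquiv.apply_symm_apply]
    simpa using h

/-- ROTATION INVARIANCE of the surface measure: `σ(rotSphere V ⁻¹' s) = σ(s)`. -/
theorem sphereMeasure_preimage_rotSphere (V : G2) {s : Set (sphere (0 : R4) 1)}
    (hs : MeasurableSet s) : sphereMeasure (rotSphere V ⁻¹' s) = sphereMeasure s := by
  have hs' : MeasurableSet (rotSphere V ⁻¹' s) := (continuous_rotSphere V).measurable hs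
  rw [sphereMeasure, toSphere_apply' _ hs', toSphere_apply' _ hs, cone_preimage_rotSphere]
  congr 1
  have hf : MeasurePreserving ((rot V).toHomeomorph.toMeasurableEquiv) volume volume := by
    simpa using (rot V).measurePreserving
  have := hf.measure_preimage_equiv (Ioo (0 : ℝ) 1 • (((↑) : sphere (0 : R4) 1 → R4) '' s))
  simpa using this

/-- The surface measure transported to `SU(2)` along `homeoS3`. -/
def liftMeasure : Measure G2 := sphereMeasure.map homeoS3.symm

/-- `liftMeasure A = σ(homeoS3.symm ⁻¹' A)`. -/
theorem liftMeasure_apply {A : Set G2} (hA : MeasurableSet A) :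
    liftMeasure A = sphereMeasure (homeoS3.symm ⁻¹' A) := by
  rw [liftMeasure, Measure.map_apply homeoS3.symm.continuous.measurable hA]

/-- `liftMeasure` is finite. -/
instance : IsFiniteMeasure liftMeasure := by
  unfold liftMeasure; infer_instance

/-- `liftMeasure` is LEFT-INVARIANT (left multiplication is a rotation of `S³`). -/
instance : liftMeasure.IsMulLeftInvariant := by
  refine ⟨fun g => ?_⟩
  ext A hA
  rw [Measure.map_apply (measurable_const_mul g) hA, liftMeasure_apply hA,
    liftMeasure_apply (measurable_const_mul g hA)]
  have hset : homeoS3.symm ⁻¹' ((fun x => g * x) ⁻¹' A) = rotSphere g ⁻¹' (homeoS3.symm ⁻¹' A) := by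
    ext y
    simp only [Set.mem_preimage, mul_homeoS3_symm]
  rw [hset, sphereMeasure_preimage_rotSphere g (homeoS3.symm.continuous.measurable hA)]

/-- HAAR UNIQUENESS: the transported surface measure is `σ(S³) •` the Haar probability measure
of `SU(2)`. -/
theorem liftMeasure_eq_smul :
    liftMeasure = liftMeasure univ • haarProbability G2 := by
  haveI : SecondCountableTopology (Matrix (Fin 2) (Fin 2) ℂ) :=
    inferInstanceAs (SecondCountableTopology (Fin 2 → Fin 2 → ℂ))
  haveI : SecondCountableTopology G2 := Topology.IsEmbedding.subtypeVal.secondCountableTopology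
  have h := Measure.haarMeasure_unique liftMeasure (⊤ : TopologicalSpace.PositiveCompacts G2)
  rw [TopologicalSpace.PositiveCompacts.coe_top] at h
  exact h

/-- Total mass of the transported measure = `σ(S³) = 4 · vol(unit ball of ℝ⁴)`. -/
theorem liftMeasure_univ : liftMeasure univ = 4 * volume (ball (0 : R4) 1) := by
  rw [liftMeasure_apply MeasurableSet.univ, Set.preimage_univ, sphereMeasure,
    toSphere_apply_univ]
  simp

/-- `σ(S³)` is neither `0` nor `∞`. -/
theorem liftMeasure_univ_ne_zero : liftMeasure univ ≠ 0 := by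
  rw [liftMeasure_univ]
  exact mul_ne_zero (by norm_num) (measure_ball_pos volume (0 : R4) one_pos).ne'

/-- `σ(S³) < ∞`. -/
theorem liftMeasure_univ_ne_top : liftMeasure univ ≠ ∞ := measure_ne_top _ _

/-- Haar probability of a Borel set of `SU(2)` = normalised surface measure of its image in `S³`. -/
theorem haarProbability_apply {A : Set G2} (hA : MeasurableSet A) :
    haarProbability G2 A = sphereMeasure (homeoS3.symm ⁻¹' A) / liftMeasure univ := by
  have h := liftMeasure_eq_smul
  have hA' : liftMeasure A = liftMeasure univ * haarProbability G2 A := by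
    conv_lhs => rw [h]
    simp [Measure.smul_apply]
  rw [← liftMeasure_apply hA, hA', mul_comm,
    ENNReal.mul_div_cancel_right liftMeasure_univ_ne_zero liftMeasure_univ_ne_top]

/-- The spherical cap of `S³` that corresponds to the action ball of radius `r`:
`{y : 2 - 2·y₀ ≤ r²}`. -/
def cap (r : ℝ) : Set (sphere (0 : R4) 1) := {y | 2 - 2 * (y : R4) 0 ≤ r ^ 2}

/-- The cap is a closed, hence measurable, subset of the sphere. -/
theorem measurableSet_cap (r : ℝ) : MeasurableSet (cap r) := by
  have hc : Continuous fun y : sphere (0 : R4) 1 => 2 - 2 * (y : R4) 0 :=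
    continuous_const.sub (continuous_const.mul ((PiLp.continuous_apply 2 _ 0).comp
      continuous_subtype_val))
  exact (isClosed_le hc continuous_const).measurableSet

/-- `Re tr U = 2 · Re U₀₀` on `SU(2)`. -/
theorem trace_re (U : G2) : (U : Matrix (Fin 2) (Fin 2) ℂ).trace.re =
    2 * ((U : Matrix (Fin 2) (Fin 2) ℂ) 0 0).re := by
  rw [Matrix.trace_fin_two, Complex.add_re, apply_one_one, Complex.conj_re]
  ring

/-- The action ball pulls back to the cap: `homeoS3.symm ⁻¹' {2 - Re tr ≤ r²} = cap r`. -/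
theorem preimage_actionBall (r : ℝ) :
    homeoS3.symm ⁻¹' {U : G2 | 2 - (U : Matrix (Fin 2) (Fin 2) ℂ).trace.re ≤ r ^ 2} = cap r := by
  ext y
  simp only [Set.mem_preimage, Set.mem_setOf_eq, cap, trace_re]
  have h0 : (((homeoS3.symm y : G2) : Matrix (Fin 2) (Fin 2) ℂ) 0 0).re = (y : R4) 0 := by
    have h1 : (toS3 (homeoS3.symm y) : R4) 0 = (y : R4) 0 := by rw [toS3_homeoS3_symm]
    rwa [coe_toS3, toR4_apply_zero] at h1
  rw [h0]

/-- The action ball is measurable. -/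
theorem measurableSet_actionBall (r : ℝ) :
    MeasurableSet {U : G2 | 2 - (U : Matrix (Fin 2) (Fin 2) ℂ).trace.re ≤ r ^ 2} := by
  have hc : Continuous fun U : G2 => 2 - (U : Matrix (Fin 2) (Fin 2) ℂ).trace.re :=
    continuous_const.sub (Complex.continuous_re.comp
      (continuous_subtype_val.matrix_trace))
  exact (isClosed_le hc continuous_const).measurableSet

/-- THE FORMULA: `Haar_{SU(2)}{U : 2 - Re tr U ≤ r²} = vol(Ioo 0 1 • cap r) / vol(unit ball)`
(the factor `dim ℝ⁴ = 4` of `toSphere` cancels). -/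
theorem haarProbability_actionBall (r : ℝ) :
    haarProbability G2 {U : G2 | 2 - (U : Matrix (Fin 2) (Fin 2) ℂ).trace.re ≤ r ^ 2} =
      volume (Ioo (0 : ℝ) 1 • (((↑) : sphere (0 : R4) 1 → R4) '' cap r)) /
        volume (ball (0 : R4) 1) := by
  rw [haarProbability_apply (measurableSet_actionBall r), preimage_actionBall, sphereMeasure,
    toSphere_apply' _ (measurableSet_cap r), liftMeasure_univ]
  have h4 : (Module.finrank ℝ R4 : ℝ≥0∞) = 4 := by simp
  rw [h4]
  rw [ENNReal.mul_div_mul_left _ _ (by norm_num) (by norm_num)]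

end Summit.Ventures.LatticeQCDFlow.Theory2.Lattice.SU2

end
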